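import Mathlib
import Summits.Ventures.HodgeRepro.Tier4.Common.SettingOfData
import Summits.Ventures.HodgeRepro.Tier4.Line1.SpectralRegroup
import Summits.Ventures.HodgeRepro.Tier4.Line1.ConvTest
import Summits.Ventures.HodgeRepro.Tier4.Line4.GeometricBridge
import Summits.Ventures.HodgeRepro.Tier4.Line4.RieszOnSetting

/-!
# Tier4/Line4/W4SpectralBridge — W4 (V4.2) on the DEFINED objects: `Jc(f₁ ⋆ f₂)` is a FINITE sum over admissible
constituents of `λ_i · P_χ(v_i)` with `v_i` the Riesz vector of the `T′`-period `P_{χ′}` (the Riesz/Parseval bridge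
from L1's `rtf_spectral`, instantiated on `Setting.ofAdelicData`)

Blind re-derivation cell `pub-hodge-repro`, Tier 4 (README §9–§10), seat t4-L1-p5 (prover, LINE L1, gen 2; the lead's
cut S13277 for LINE L4's W4, target shape adjudicated by t4-L4-p1 S13295).  On typer-2's setting of the defined objects
(`Setting.ofAdelicData W R μ DG fdG compG compT compT'`) with an adapted orthonormal basis `φ` (L1's J1), L1's spectral
expansion of `J = Jc` (`Jc_eq_J`, t4-L4-p2; `rtf_spectral`, t4-L1-p4) is regrouped (`SpectralRegroup`, L1) over finitely
many pairwise disjoint blocks `F i` of the basis on which `R(f̄₁)`, `R(f₂ˇ)` act by the DISPLAYED scalars `a i`, `b i`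
and outside which `R(f̄₁)` vanishes (the admissible projector), giving
`R.Jc (f₁ ⋆ f₂) = ∑ i, (b i · conj (a i)) · R.periodT (restrictTo (torusT W) (v i))` (`Jc_eq_sum_riesz`), where
`v i = rieszOf (F i) (conj ∘ φ) P_{χ′}` is the RIESZ VECTOR, for the `L²(D_G)` pairing `innerDG`, of the `T′`-period
`P_{χ′} = R.periodT' ∘ restrictTo (torusT' W)` (typer-2's `periodLin` with `χ′` UN-conjugated, t4-L4-p1's convention of
`IsRieszVectorOn`) on the CONJUGATE block `{conj ∘ φ j : j ∈ F i}` (`innerDG_conj_rieszOf`, `isRieszVectorOn_rieszOf`).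
THE CONJUGATION (honest reading): L1's kernel expansion `K_f(x, y) = ∑_j R(f₂ˇ)φ_j(y) · conj(R(f̄₁)φ_j(x))` carries the
conjugate on the `T`-slot, so the `T`-periods that appear are those of `conj ∘ φ_j`; the Riesz vector therefore lives
on the conjugate block, i.e. on the `K`-type space of the CONJUGATE constituent `V̄_i` (its `K`-types are the negatives);
a consumer that needs the Riesz vector on `kTypeSpace … K (V i)` itself takes the family `φ` closed under conjugation
(`V ↦ V̄` permutes the admissible constituents).  NOTHING automorphic is asserted: the finiteness of the admissible
spectrum at the level, the eigen-relations and the vanishing are the displayed inputs of W4 (crit-2's R2 caveat).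

Nothing here says anything about the status of the Hodge conjecture for CM abelian varieties, which is NOT proved
(HC_CM is NOT proved by anyone in this repository).
-/

set_option autoImplicit false

noncomputable section

namespace Summit.Ventures.HodgeRepro.Tier4.Line4

open Summit.Ventures.HodgeRepro.Tier4.Common Summit.Ventures.HodgeRepro.Tier4.Line1 MeasureTheory NumberField
open scoped ComplexConjugate

section Bridge

variable {k : Type} [Field k] [NumberField k] (W : PlaneData k) [MeasurableSpace (GA W)] [BorelSpace (GA W)]
  (R : RTFData W) (μ : Measure (GA W)) [μ.IsHaarMeasure] [R.μT.IsHaarMeasure] [R.μT'.IsHaarMeasure]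
  (DG : Set (GA W)) (fdG : IsFundamentalDomain (rationalPoints W) DG μ) (compG : IsCompact (closure DG))
  (compT : IsCompact (closure R.DT)) (compT' : IsCompact (closure R.DT'))

omit [BorelSpace (GA W)] [μ.IsHaarMeasure] [R.μT.IsHaarMeasure] [R.μT'.IsHaarMeasure] in
/-- a continuous function is integrable on a set with compact closure (measure finite on compacts) -/
theorem integrableOn_of_continuous_of_isCompact_closure {X : Type} [TopologicalSpace X] [MeasurableSpace X]
    [OpensMeasurableSpace X] (ν : Measure X) [IsFiniteMeasureOnCompacts ν] {D : Set X}
    (hD : IsCompact (closure D)) {f : X → ℂ} (hf : Continuous f) : IntegrableOn f D ν :=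
  (hf.continuousOn.integrableOn_compact' hD isClosed_closure.measurableSet).mono_set subset_closure

/-- **the `T′`-period of the setting is `P_{conj χ′}` of typer-2 on continuous functions**:
`∫_{D_{T′}} φ · conj χ′ = R.periodT'conj (φ|_{T′})` -/
theorem periodT'_eq_periodT'conj (hc' : Continuous R.chi') {φ : GA W → ℂ} (hφ : Continuous φ) :
    (Setting.ofAdelicData W R μ DG fdG compG compT compT').periodT' R.chi' (restrictTo W (torusT' W) φ) =
      R.periodT'conj (restrictTo W (torusT' W) φ) := by
  haveI : IsFiniteMeasureOnCompacts R.μT' := (inferInstance : R.μT'.IsHaarMeasure).toIsFiniteMeasureOnCompacts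
  have hint : Integrable (fun t : torusT' W => R.chi'conj t * restrictTo W (torusT' W) φ t)
      (R.μT'.restrict R.DT') := by
    refine integrableOn_of_continuous_of_isCompact_closure R.μT' compT' ?_
    exact (Complex.continuous_conj.comp hc').mul (hφ.comp continuous_subtype_val)
  unfold RTF.Setting.periodT'
  rw [RTFData.periodT'conj, periodLin_eq_integral W R.μT' R.DT' R.chi'conj hint]
  refine integral_congr_ae (Filter.Eventually.of_forall fun t => ?_)
  simp only [RTFData.chi'conj]
  ring

/-- **the conjugate `T`-period of the setting is `P_χ` of typer-2 on the conjugate function**: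
`conj (∫_{D_T} φ · conj χ) = R.periodT ((conj ∘ φ)|_T)` -/
theorem conj_periodT_eq (hc : Continuous R.chi) {φ : GA W → ℂ} (hφ : Continuous φ) :
    conj ((Setting.ofAdelicData W R μ DG fdG compG compT compT').periodT R.chi (restrictTo W (torusT W) φ)) =
      R.periodT (restrictTo W (torusT W) (fun x => conj (φ x))) := by
  haveI : IsFiniteMeasureOnCompacts R.μT := (inferInstance : R.μT.IsHaarMeasure).toIsFiniteMeasureOnCompacts
  have hint : Integrable (fun t : torusT W => R.chi t * restrictTo W (torusT W) (fun x => conj (φ x)) t)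
      (R.μT.restrict R.DT) := by
    refine integrableOn_of_continuous_of_isCompact_closure R.μT compT ?_
    exact hc.mul (Complex.continuous_conj.comp (hφ.comp continuous_subtype_val))
  unfold RTF.Setting.periodT
  rw [RTFData.periodT, periodLin_eq_integral W R.μT R.DT R.chi hint, ← integral_conj]
  refine integral_congr_ae (Filter.Eventually.of_forall fun t => ?_)
  simp only [restrictTo, map_mul, Complex.conj_conj]
  ring

/-- the right-regular action of the setting is typer-2's `rightRegular` -/
theorem R_ofAdelicData_eq (f φ : GA W → ℂ) :
    (Setting.ofAdelicData W R μ DG fdG compG compT compT').R f φ = rightRegular W μ f φ := rfl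

/-- `P_{χ′}` of typer-2, as a functional on functions of `G(𝔸_k)` -/
def periodT'Fun (ψ : GA W → ℂ) : ℂ := R.periodT' (restrictTo W (torusT' W) ψ)

/-- **THE RIESZ VECTOR on the conjugate block**: `innerDG (conj ∘ φ j) (rieszOf F (conj ∘ φ) P) = P (conj ∘ φ j)`
for `j ∈ F` and an adapted orthonormal basis `φ` of the setting. -/
theorem innerDG_conj_rieszOf {τ : ℕ → Set (GA W → ℂ)} {φ : ℕ → GA W → ℂ} {n : ℕ → ℕ}
    (hB : (Setting.ofAdelicData W R μ DG fdG compG compT compT').IsAdaptedONB τ φ n)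
    (F : Finset ℕ) (P : (GA W → ℂ) → ℂ) {j : ℕ} (hj : j ∈ F) :
    innerDG μ DG (fun x => conj (φ j x)) (RTF.Setting.rieszOf F (fun l x => conj (φ l x)) P) =
      P (fun x => conj (φ j x)) := by
  set S := Setting.ofAdelicData W R μ DG fdG compG compT compT' with hS
  have hcont : ∀ l, Continuous (φ l) := fun l => (hB.inv (n l)).cont _ (hB.mem l)
  have hcontc : ∀ l, Continuous (fun x => conj (φ l x)) := fun l => Complex.continuous_conj.comp (hcont l)
  rw [← inner_ofAdelicData_eq W R μ DG fdG compG compT compT']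
  unfold RTF.Setting.rieszOf
  rw [S.inner_finset_sum_right _ (hcontc j) F _ _ (fun l _ => hcontc l)]
  have horth : ∀ l, S.inner (fun x => conj (φ j x)) (fun x => conj (φ l x)) = if j = l then 1 else 0 := by
    intro l
    have h := hB.orth j l
    rw [RTF.Setting.inner] at h ⊢
    have h2 : (fun x => conj (φ j x) * starRingEnd ℂ (conj (φ l x))) =
        fun x => conj (φ j x * starRingEnd ℂ (φ l x)) := by
      funext x
      simp only [map_mul, Complex.conj_conj]
    rw [h2, integral_conj, h]
    split_ifs <;> simp
  simp only [horth, Complex.conj_conj]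
  rw [Finset.sum_eq_single j]
  · simp
  · intro l _ hl
    simp [Ne.symm hl]
  · intro h
    exact absurd hj h

/-- **W4 (V4.2) ON THE DEFINED OBJECTS, constituents form**: with the eigen-relations and the vanishing displayed,
`R.Jc (f₁ ⋆ f₂) = ∑ i, b i conj (a i) ∑_{j ∈ F i} P_{conj χ′}(φ_j) · P_χ(conj ∘ φ_j)`. -/
theorem Jc_eq_sum_constituents (hc : Continuous R.chi) (hu : ∀ a, ‖R.chi a‖ = 1)
    (hc' : Continuous R.chi') (hu' : ∀ a, ‖R.chi' a‖ = 1)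
    {τ : ℕ → Set (GA W → ℂ)} {φ : ℕ → GA W → ℂ} {n : ℕ → ℕ}
    (hB : (Setting.ofAdelicData W R μ DG fdG compG compT compT').IsAdaptedONB τ φ n)
    {f₁ f₂ : GA W → ℂ} (h₁ : IsTestFn W f₁) (h₂ : IsTestFn W f₂) {m : ℕ} (F : Fin m → Finset ℕ)
    (hdisj : ∀ i i', i ≠ i' → Disjoint (F i) (F i')) (a b : Fin m → ℂ)
    (ha : ∀ i, ∀ j ∈ F i, rightRegular W μ (RTF.cj f₁) (φ j) = fun x => a i * φ j x)
    (hb : ∀ i, ∀ j ∈ F i, rightRegular W μ (RTF.refl f₂) (φ j) = fun x => b i * φ j x)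
    (hvan : ∀ j, (∀ i, j ∉ F i) → rightRegular W μ (RTF.cj f₁) (φ j) = fun _ => 0) :
    R.Jc ((Setting.ofAdelicData W R μ DG fdG compG compT compT').conv f₁ f₂) =
      ∑ i, b i * conj (a i) * ∑ j ∈ F i, R.periodT'conj (restrictTo W (torusT' W) (φ j)) *
        R.periodT (restrictTo W (torusT W) (fun x => conj (φ j x))) := by
  set S := Setting.ofAdelicData W R μ DG fdG compG compT compT' with hS
  haveI := t2Space_GA W
  have h₁' : RTF.IsTest f₁ := ⟨h₁.1, h₁.2⟩
  have h₂' : RTF.IsTest f₂ := ⟨h₂.1, h₂.2⟩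
  have hconv : IsTestFn W (S.conv f₁ f₂) :=
    ⟨(S.conv_isTest h₁' h₂').1.cont, (S.conv_isTest h₁' h₂').1.compact⟩
  have hcont : ∀ l, Continuous (φ l) := fun l => (hB.inv (n l)).cont _ (hB.mem l)
  rw [Jc_eq_J W R μ DG fdG compG compT compT' hc hc' hconv,
    S.J_eq_sum_constituents (isCharacter_chi W R μ DG fdG compG compT compT' hc hu)
      (isCharacter'_chi' W R μ DG fdG compG compT compT' hc' hu') hB h₁' h₂' F hdisj a b ha hb hvan]
  refine Finset.sum_congr rfl fun i _ => ?_
  congr 1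
  refine Finset.sum_congr rfl fun j _ => ?_
  rw [← periodT'_eq_periodT'conj W R μ DG fdG compG compT compT' hc' (hcont j),
    ← conj_periodT_eq W R μ DG fdG compG compT compT' hc (hcont j)]
  rfl

/-- **W4 (V4.2) ON THE DEFINED OBJECTS, RIESZ FORM** (t4-L4-p1's target shape S13295):
`R.Jc (f₁ ⋆ f₂) = ∑ i, (b i · conj (a i)) · P_χ(v_i)` with `v_i = rieszOf (F i) (conj ∘ φ) P_{χ′}` the Riesz vector of
`P_{χ′} = R.periodT' ∘ restrictTo (torusT' W)` on the conjugate block. -/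
theorem Jc_eq_sum_riesz (hc : Continuous R.chi) (hu : ∀ a, ‖R.chi a‖ = 1)
    (hc' : Continuous R.chi') (hu' : ∀ a, ‖R.chi' a‖ = 1)
    {τ : ℕ → Set (GA W → ℂ)} {φ : ℕ → GA W → ℂ} {n : ℕ → ℕ}
    (hB : (Setting.ofAdelicData W R μ DG fdG compG compT compT').IsAdaptedONB τ φ n)
    {f₁ f₂ : GA W → ℂ} (h₁ : IsTestFn W f₁) (h₂ : IsTestFn W f₂) {m : ℕ} (F : Fin m → Finset ℕ)
    (hdisj : ∀ i i', i ≠ i' → Disjoint (F i) (F i')) (a b : Fin m → ℂ)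
    (ha : ∀ i, ∀ j ∈ F i, rightRegular W μ (RTF.cj f₁) (φ j) = fun x => a i * φ j x)
    (hb : ∀ i, ∀ j ∈ F i, rightRegular W μ (RTF.refl f₂) (φ j) = fun x => b i * φ j x)
    (hvan : ∀ j, (∀ i, j ∉ F i) → rightRegular W μ (RTF.cj f₁) (φ j) = fun _ => 0) :
    R.Jc ((Setting.ofAdelicData W R μ DG fdG compG compT compT').conv f₁ f₂) =
      ∑ i, b i * conj (a i) * R.periodT (restrictTo W (torusT W)
        (RTF.Setting.rieszOf (F i) (fun l x => conj (φ l x)) (periodT'Fun W R))) := by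
  rw [Jc_eq_sum_constituents W R μ DG fdG compG compT compT' hc hu hc' hu' hB h₁ h₂ F hdisj a b ha hb hvan]
  haveI : IsFiniteMeasureOnCompacts R.μT' := (inferInstance : R.μT'.IsHaarMeasure).toIsFiniteMeasureOnCompacts
  have hcont : ∀ l, Continuous (φ l) := fun l => (hB.inv (n l)).cont _ (hB.mem l)
  refine Finset.sum_congr rfl fun i _ => ?_
  congr 1
  -- the Riesz vector restricted to `T`, as a finite linear combination
  have hres : restrictTo W (torusT W) (RTF.Setting.rieszOf (F i) (fun l x => conj (φ l x)) (periodT'Fun W R)) =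
      ∑ j ∈ F i, conj (periodT'Fun W R (fun x => conj (φ j x))) • restrictTo W (torusT W) (fun x => conj (φ j x)) := by
    funext t
    simp only [RTF.Setting.rieszOf, restrictTo, Finset.sum_apply, Pi.smul_apply, smul_eq_mul]
  rw [hres, map_sum]
  refine Finset.sum_congr rfl fun j _ => ?_
  rw [map_smul, smul_eq_mul]
  congr 1
  -- `conj (P_{χ′}(conj ∘ φ_j)) = P_{conj χ′}(φ_j)`
  have hint : Integrable (fun t : torusT' W => R.chi' t * restrictTo W (torusT' W) (fun x => conj (φ j x)) t)
      (R.μT'.restrict R.DT') := by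
    refine integrableOn_of_continuous_of_isCompact_closure R.μT' compT' ?_
    exact hc'.mul (Complex.continuous_conj.comp ((hcont j).comp continuous_subtype_val))
  have hint' : Integrable (fun t : torusT' W => R.chi'conj t * restrictTo W (torusT' W) (φ j) t)
      (R.μT'.restrict R.DT') := by
    refine integrableOn_of_continuous_of_isCompact_closure R.μT' compT' ?_
    exact (Complex.continuous_conj.comp hc').mul ((hcont j).comp continuous_subtype_val)
  rw [periodT'Fun, RTFData.periodT', periodLin_eq_integral W R.μT' R.DT' R.chi' hint, ← integral_conj,
    RTFData.periodT'conj, periodLin_eq_integral W R.μT' R.DT' R.chi'conj hint']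
  refine integral_congr_ae (Filter.Eventually.of_forall fun t => ?_)
  simp only [restrictTo, RTFData.chi'conj, map_mul, Complex.conj_conj]

omit [R.μT.IsHaarMeasure] [R.μT'.IsHaarMeasure] in
/-- the pairing `innerDG` is additive in the first argument on continuous functions -/
theorem innerDG_add_left (compG : IsCompact (closure DG)) {x y v : GA W → ℂ} (hx : Continuous x)
    (hy : Continuous y) (hv : Continuous v) :
    innerDG μ DG (x + y) v = innerDG μ DG x v + innerDG μ DG y v := by
  haveI : IsFiniteMeasureOnCompacts μ := (inferInstance : μ.IsHaarMeasure).toIsFiniteMeasureOnCompacts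
  unfold innerDG
  have h : ∀ z, (x + y) z * conj (v z) = x z * conj (v z) + y z * conj (v z) := fun z => by
    simp only [Pi.add_apply]; ring
  simp_rw [h]
  exact integral_add
    (integrableOn_of_continuous_of_isCompact_closure μ compG (hx.mul (Complex.continuous_conj.comp hv)))
    (integrableOn_of_continuous_of_isCompact_closure μ compG (hy.mul (Complex.continuous_conj.comp hv)))

omit [BorelSpace (GA W)] [μ.IsHaarMeasure] [R.μT.IsHaarMeasure] [R.μT'.IsHaarMeasure] in
/-- the pairing `innerDG` is homogeneous in the first argument -/
theorem innerDG_smul_left (c : ℂ) (x v : GA W → ℂ) : innerDG μ DG (c • x) v = c * innerDG μ DG x v := by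
  unfold innerDG
  have h : ∀ z, (c • x) z * conj (v z) = c * (x z * conj (v z)) := fun z => by
    simp only [Pi.smul_apply, smul_eq_mul]; ring
  simp_rw [h]
  exact integral_const_mul c _

omit [BorelSpace (GA W)] [μ.IsHaarMeasure] [R.μT.IsHaarMeasure] [R.μT'.IsHaarMeasure] in
/-- the pairing with the zero function vanishes -/
theorem innerDG_zero_right (x : GA W → ℂ) : innerDG μ DG x 0 = 0 := by
  unfold innerDG
  simp

omit [BorelSpace (GA W)] [μ.IsHaarMeasure] [R.μT.IsHaarMeasure] [R.μT'.IsHaarMeasure] in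
/-- `P_{χ′}` on functions of `G(𝔸_k)` is linear -/
theorem periodT'Fun_add (x y : GA W → ℂ) : periodT'Fun W R (x + y) = periodT'Fun W R x + periodT'Fun W R y := by
  unfold periodT'Fun
  have h : restrictTo W (torusT' W) (x + y) = restrictTo W (torusT' W) x + restrictTo W (torusT' W) y := rfl
  rw [h, map_add]

omit [BorelSpace (GA W)] [μ.IsHaarMeasure] [R.μT.IsHaarMeasure] [R.μT'.IsHaarMeasure] in
/-- `P_{χ′}` on functions of `G(𝔸_k)` is homogeneous -/
theorem periodT'Fun_smul (c : ℂ) (x : GA W → ℂ) : periodT'Fun W R (c • x) = c * periodT'Fun W R x := by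
  unfold periodT'Fun
  have h : restrictTo W (torusT' W) (c • x) = c • restrictTo W (torusT' W) x := rfl
  rw [h, map_smul, smul_eq_mul]

omit [BorelSpace (GA W)] [μ.IsHaarMeasure] [R.μT.IsHaarMeasure] [R.μT'.IsHaarMeasure] in
/-- `P_{χ′}` of the zero function vanishes -/
theorem periodT'Fun_zero : periodT'Fun W R 0 = 0 := by
  unfold periodT'Fun
  have h : restrictTo W (torusT' W) (0 : GA W → ℂ) = 0 := rfl
  rw [h, map_zero]

/-- **THE RIESZ VECTOR IS `IsRieszVectorOn`** (t4-L4-p1's shape, S13295 (iii)–(iv)): on `Vτ = span {conj ∘ φ j : j ∈ F}`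
(displayed: the block spans the whole `K`-type space — exactness) with some `P_{χ′}(conj ∘ φ j) ≠ 0`,
`rieszOf F (conj ∘ φ) P_{χ′}` is a Riesz vector of the `T′`-period on `Vτ` for the `L²(D_G)` pairing. -/
theorem isRieszVectorOn_rieszOf {τ : ℕ → Set (GA W → ℂ)} {φ : ℕ → GA W → ℂ} {n : ℕ → ℕ}
    (hB : (Setting.ofAdelicData W R μ DG fdG compG compT compT').IsAdaptedONB τ φ n)
    (F : Finset ℕ) (Vτ : Submodule ℂ (GA W → ℂ))
    (hVτ : Vτ = Submodule.span ℂ ((fun j => fun x => conj (φ j x)) '' (F : Set ℕ)))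
    (hne : ∃ j ∈ F, periodT'Fun W R (fun x => conj (φ j x)) ≠ 0) :
    IsRieszVectorOn R μ DG Vτ (RTF.Setting.rieszOf F (fun l x => conj (φ l x)) (periodT'Fun W R)) := by
  have hcont : ∀ l, Continuous (φ l) := fun l => (hB.inv (n l)).cont _ (hB.mem l)
  have hcontc : ∀ l, Continuous (fun x => conj (φ l x)) := fun l => Complex.continuous_conj.comp (hcont l)
  set v : GA W → ℂ := RTF.Setting.rieszOf F (fun l x => conj (φ l x)) (periodT'Fun W R) with hv
  have hvsum : v = ∑ j ∈ F, conj (periodT'Fun W R (fun x => conj (φ j x))) • (fun x => conj (φ j x)) := by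
    funext x
    simp only [hv, RTF.Setting.rieszOf, Finset.sum_apply, Pi.smul_apply, smul_eq_mul]
  have hvcont : Continuous v := by
    show Continuous fun x => ∑ j ∈ F, conj (periodT'Fun W R (fun x => conj (φ j x))) * conj (φ j x)
    exact continuous_finsetSum F fun j _ => continuous_const.mul (hcontc j)
  refine ⟨?_, ?_, ?_⟩
  · rw [hVτ, hvsum]
    exact Submodule.sum_mem _ fun j hj =>
      Submodule.smul_mem _ _ (Submodule.subset_span ⟨j, hj, rfl⟩)
  · obtain ⟨j, hj, hPj⟩ := hne
    intro h0
    apply hPj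
    rw [← innerDG_conj_rieszOf W R μ DG fdG compG compT compT' hB F (periodT'Fun W R) hj, ← hv, h0,
      innerDG_zero_right]
  · intro ψ hψ
    rw [hVτ] at hψ
    refine (Submodule.span_induction (p := fun ψ _ => innerDG μ DG ψ v = periodT'Fun W R ψ ∧ Continuous ψ)
      ?_ ?_ ?_ ?_ hψ).1
    · rintro _ ⟨j, hj, rfl⟩
      exact ⟨innerDG_conj_rieszOf W R μ DG fdG compG compT compT' hB F (periodT'Fun W R) hj, hcontc j⟩
    · refine ⟨?_, continuous_const⟩
      rw [periodT'Fun_zero]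
      unfold innerDG
      simp
    · rintro x y _ _ ⟨hx, hxc⟩ ⟨hy, hyc⟩
      refine ⟨?_, hxc.add hyc⟩
      rw [innerDG_add_left W μ DG compG hxc hyc hvcont, hx, hy, periodT'Fun_add]
    · rintro c x _ ⟨hx, hxc⟩
      refine ⟨?_, continuous_const.mul hxc⟩
      rw [innerDG_smul_left, hx, periodT'Fun_smul]

/-- **W4 ∧ W5 ⇒ a block with a non-zero mixed term**: if `Jc(f₁ ⋆ f₂) ≠ 0` then some constituent has
`λ_i = b_i conj(a_i) ≠ 0` and a non-zero `T`-period of its Riesz vector. -/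
theorem exists_block_of_Jc_ne_zero (hc : Continuous R.chi) (hu : ∀ a, ‖R.chi a‖ = 1)
    (hc' : Continuous R.chi') (hu' : ∀ a, ‖R.chi' a‖ = 1)
    {τ : ℕ → Set (GA W → ℂ)} {φ : ℕ → GA W → ℂ} {n : ℕ → ℕ}
    (hB : (Setting.ofAdelicData W R μ DG fdG compG compT compT').IsAdaptedONB τ φ n)
    {f₁ f₂ : GA W → ℂ} (h₁ : IsTestFn W f₁) (h₂ : IsTestFn W f₂) {m : ℕ} (F : Fin m → Finset ℕ)
    (hdisj : ∀ i i', i ≠ i' → Disjoint (F i) (F i')) (a b : Fin m → ℂ)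
    (ha : ∀ i, ∀ j ∈ F i, rightRegular W μ (RTF.cj f₁) (φ j) = fun x => a i * φ j x)
    (hb : ∀ i, ∀ j ∈ F i, rightRegular W μ (RTF.refl f₂) (φ j) = fun x => b i * φ j x)
    (hvan : ∀ j, (∀ i, j ∉ F i) → rightRegular W μ (RTF.cj f₁) (φ j) = fun _ => 0)
    (hJ : R.Jc ((Setting.ofAdelicData W R μ DG fdG compG compT compT').conv f₁ f₂) ≠ 0) :
    ∃ i, b i * conj (a i) ≠ 0 ∧ R.periodT (restrictTo W (torusT W)
      (RTF.Setting.rieszOf (F i) (fun l x => conj (φ l x)) (periodT'Fun W R))) ≠ 0 := by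
  rw [Jc_eq_sum_riesz W R μ DG fdG compG compT compT' hc hu hc' hu' hB h₁ h₂ F hdisj a b ha hb hvan] at hJ
  obtain ⟨i, _, hi⟩ := Finset.exists_ne_zero_of_sum_ne_zero hJ
  exact ⟨i, (mul_ne_zero_iff.mp hi).1, (mul_ne_zero_iff.mp hi).2⟩

end Bridge

end Summit.Ventures.HodgeRepro.Tier4.Line4

end
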